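import Mathlib.MeasureTheory.VectorMeasure.Decomposition.Lebesgue
import Mathlib.MeasureTheory.VectorMeasure.WithDensity
import Mathlib.MeasureTheory.Group.Prod
import Mathlib.MeasureTheory.Group.Integral
import Mathlib.MeasureTheory.Integral.Prod
import Literature.Probability.Percolation.FKLoopNestingGaussianLimit
import Literature.Analysis.FunctionSpaces.BMOLogProofs
import HarnessLib

/-!
# DKLM 2026, Corollary 10: densities are finite-energy generalised test functions

API for the hypotheses of the named fact `Literature.Probability.Percolation.dklm2026_corollary10`
(`Literature/Probability/Percolation/FKLoopNestingGaussianLimit.lean`; Duminil-Copin–Kozlowski–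
Lammers–Manolescu, arXiv:2603.06268, Cor. 10), whose test functions are DKLM's *generalised test
functions of finite Dirichlet energy* (Def. 5, Def. 6(ii)): `IsGeneralisedTestFunction φ`,
`HasFiniteDirichletEnergy φ` for a signed measure `φ` on the plane, the energy
`dirichletEnergy φ = ∬ G_{ℝ²} dφ dφ` being computed through the Jordan decomposition
(`signedIntegral`). Nothing here is about Cor. 10 itself (a theory: Thm. 8 of the paper plus the
Baxter–Kelland–Wu identity of its §3.2); this file supplies what every *use* of the fact with a
test function given by a density needs (continued in `FKLoopNestingDensityLimit`):

* **Signed measures with a density** (`section Density`, any measure `μ` on `ℂ`): the Jordan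
  decomposition, total variation and `signedIntegral` of `μ.withDensityᵥ f`
  (`totalVariation_withDensityᵥ`: `|f · μ| = |f| · μ`; `signedIntegral_withDensityᵥ`:
  `∫ g d(f · μ) = ∫ f g dμ`) — small gaps of Mathlib, which has the Jordan decomposition
  (`SignedMeasure.toJordanDecomposition_eq_of_eq_add_withDensity`) but no integral against signed
  measures.
* **The logarithmic kernel is locally integrable on the plane squared**:
  `log ‖x - y‖ ∈ L¹(B̄(0,R) × B̄(0,R))` (`integrableOn_log_norm_sub_prod`), from `log ‖·‖ ∈ L¹_loc(ℂ)`
  (`Literature.Analysis.FunctionSpaces.BMOLog.locallyIntegrable_log_norm`, Grafakos Ex. 3.1.3)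
  transported by the measure-preserving shear `(x, y) ↦ (x, y - x)`.
* **Densities are admissible** (`section Volume`): for a measurable `f : ℂ → ℝ` with `|f| ≤ C`,
  `f = 0` off `B̄(0, R)` (and `∫ f = 0`), the signed measure `f · Leb = volume.withDensityᵥ f` is a
  generalised test function (`isGeneralisedTestFunction_withDensityᵥ`, Def. 5) of finite Dirichlet
  energy (`hasFiniteDirichletEnergy_withDensityᵥ`, Def. 6(ii)), with energy the Lebesgue double
  integral `dirichletEnergy (f · Leb) = -(1/2π) ∫ (∫ log ‖x - y‖ f(x) f(y) dy) dx`
  (`dirichletEnergy_withDensityᵥ`). In particular the hypothesis classes of the fact are far from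
  vacuous; this is the class of test functions of the consumer statement `MagicFormulaZ2` of the
  route `Summits/CriticalPhenomena/CardyFormulaZ2/Theses/CardyMagicRigidity` (the `q = 1`, density
  special case of Cor. 10).

## References

* H. Duminil-Copin, K. K. Kozlowski, P. Lammers, I. Manolescu, *Gaussian free field convergence of
  the six-vertex model with `-1 ≤ Δ ≤ -1/2`*, arXiv:2603.06268 (2026): Def. 5 (generalised test
  functions), (2.3) and Def. 6(ii) (finite Dirichlet energy), Cor. 10.
* L. Grafakos, *Modern Fourier Analysis*, 3rd ed. (2014), Example 3.1.3 (`log |x| ∈ L¹_loc`).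
-/

noncomputable section

open MeasureTheory Set Filter Metric
open scoped ENNReal Real Topology

namespace Literature.Probability.Percolation

open LatticeModels RandomPlanarGeometry

/-! ### Signed measures with a density: Jordan decomposition, total variation, integrals -/

section Density

variable {μ : Measure ℂ} {f : ℂ → ℝ}

/-- The positive part of `f · μ` is `f⁺ · μ`. [folklore] -/
theorem toJordanDecomposition_withDensityᵥ_posPart (hf : Measurable f) (hfi : Integrable f μ) :
    (SignedMeasure.toJordanDecomposition (μ.withDensityᵥ f)).posPart = μ.withDensity fun x ↦ ENNReal.ofReal (f x) := by
  rw [SignedMeasure.toJordanDecomposition_eq_of_eq_add_withDensity (t := 0) hf hfi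
    VectorMeasure.MutuallySingular.zero_left (zero_add _).symm]
  simp [SignedMeasure.toJordanDecomposition_zero, JordanDecomposition.zero_posPart]

/-- The negative part of `f · μ` is `f⁻ · μ`. [folklore] -/
theorem toJordanDecomposition_withDensityᵥ_negPart (hf : Measurable f) (hfi : Integrable f μ) :
    (SignedMeasure.toJordanDecomposition (μ.withDensityᵥ f)).negPart =
      μ.withDensity fun x ↦ ENNReal.ofReal (-f x) := by
  rw [SignedMeasure.toJordanDecomposition_eq_of_eq_add_withDensity (t := 0) hf hfi
    VectorMeasure.MutuallySingular.zero_left (zero_add _).symm]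
  simp [SignedMeasure.toJordanDecomposition_zero, JordanDecomposition.zero_negPart]

/-- **`|f · μ| = |f| · μ`**: the total variation of the signed measure with density `f` is the
measure with density `|f|`. [folklore] -/
theorem totalVariation_withDensityᵥ (hf : Measurable f) (hfi : Integrable f μ) :
    SignedMeasure.totalVariation (μ.withDensityᵥ f) = μ.withDensity fun x ↦ ‖f x‖ₑ := by
  rw [SignedMeasure.totalVariation, toJordanDecomposition_withDensityᵥ_posPart hf hfi,
    toJordanDecomposition_withDensityᵥ_negPart hf hfi, ← withDensity_add_left hf.ennreal_ofReal]
  congr 1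
  funext x
  rw [Pi.add_apply, Real.enorm_eq_ofReal_abs]
  rcases le_total 0 (f x) with h | h
  · rw [ENNReal.ofReal_of_nonpos (neg_nonpos.2 h), add_zero, abs_of_nonneg h]
  · rw [ENNReal.ofReal_of_nonpos h, zero_add, abs_of_nonpos h]

/-- `|max a 0 * b| ≤ |a * b|`. [folklore] -/
theorem abs_max_zero_mul_le (a b : ℝ) : |max a 0 * b| ≤ |a * b| := by
  rcases le_total 0 a with h | h
  · rw [max_eq_left h]
  · rw [max_eq_right h, zero_mul, abs_zero]
    exact abs_nonneg _

/-- **`∫ g d(f · μ) = ∫ f g dμ`**: the integral against the signed measure with density `f`,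
computed through the Jordan decomposition (`signedIntegral`), is the `μ`-integral of `f g`
whenever `f g` is integrable. [folklore] -/
theorem signedIntegral_withDensityᵥ (hf : Measurable f) (hfi : Integrable f μ) {g : ℂ → ℝ}
    (hg : AEStronglyMeasurable g μ) (hfg : Integrable (fun x ↦ f x * g x) μ) :
    signedIntegral (μ.withDensityᵥ f) g = ∫ x, f x * g x ∂μ := by
  rw [signedIntegral, toJordanDecomposition_withDensityᵥ_posPart hf hfi,
    toJordanDecomposition_withDensityᵥ_negPart hf hfi,
    integral_withDensity_eq_integral_toReal_smul hf.ennreal_ofReal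
      (Eventually.of_forall fun _ ↦ ENNReal.ofReal_lt_top),
    integral_withDensity_eq_integral_toReal_smul (by fun_prop : Measurable fun x ↦ ENNReal.ofReal (-f x))
      (Eventually.of_forall fun _ ↦ ENNReal.ofReal_lt_top)]
  simp only [ENNReal.toReal_ofReal', smul_eq_mul]
  have hp : Integrable (fun x ↦ max (f x) 0 * g x) μ :=
    hfg.norm.mono' ((hf.max measurable_const).aestronglyMeasurable.mul hg)
      (Eventually.of_forall fun x ↦ by
        rw [Real.norm_eq_abs, Real.norm_eq_abs]
        exact abs_max_zero_mul_le _ _)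
  have hn : Integrable (fun x ↦ max (-f x) 0 * g x) μ := by
    refine (hfg.norm.mono' ((hf.neg.max measurable_const).aestronglyMeasurable.mul hg)
      (Eventually.of_forall fun x ↦ ?_))
    rw [Real.norm_eq_abs, Real.norm_eq_abs]
    refine (abs_max_zero_mul_le _ _).trans_eq ?_
    rw [neg_mul, abs_neg]
  rw [← integral_sub hp hn]
  congr 1
  funext x
  rw [← sub_mul, max_zero_sub_max_neg_zero_eq_self]

end Density

/-! ### `log ‖x - y‖` is locally integrable on `ℂ × ℂ` -/

/-- **Local integrability of the logarithmic kernel on the plane**: `(x, y) ↦ log ‖x - y‖` is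
integrable on `B̄(0,R) × B̄(0,R)` for Lebesgue measure. Proof: `(x, w) ↦ log ‖w‖` is integrable on
`B̄(0,R) × B̄(0,2R)` (`log ‖·‖ ∈ L¹_loc(ℂ)`, Grafakos Ex. 3.1.3, times a finite measure), and the
shear `(x, y) ↦ (x, y - x)` preserves `Leb ⊗ Leb` and maps `B̄(0,R)²` into that set.
[cite: GrafakosMFA2014, Example 3.1.3] -/
theorem integrableOn_log_norm_sub_prod (R : ℝ) :
    IntegrableOn (fun z : ℂ × ℂ ↦ Real.log ‖z.1 - z.2‖) (closedBall (0 : ℂ) R ×ˢ closedBall (0 : ℂ) R)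
      ((volume : Measure ℂ).prod volume) := by
  set B : Set ℂ := closedBall 0 R
  set B' : Set ℂ := closedBall 0 (R + R)
  have hBB' : MeasurableSet (B ×ˢ B') := measurableSet_closedBall.prod measurableSet_closedBall
  -- `(x, w) ↦ log ‖w‖` is integrable on `B × B'`
  have hg : Integrable ((B ×ˢ B').indicator fun p : ℂ × ℂ ↦ Real.log ‖p.2‖)
      ((volume : Measure ℂ).prod volume) := by
    rw [integrable_indicator_iff hBB', IntegrableOn, ← Measure.prod_restrict]
    have h1 : Integrable (fun _ : ℂ ↦ (1 : ℝ)) ((volume : Measure ℂ).restrict B) :=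
      integrableOn_const (measure_closedBall_lt_top (x := (0 : ℂ)) (r := R)).ne
    have h2 : Integrable (fun w : ℂ ↦ Real.log ‖w‖) ((volume : Measure ℂ).restrict B') :=
      Literature.Analysis.FunctionSpaces.BMOLog.locallyIntegrable_log_norm.integrableOn_isCompact
        (isCompact_closedBall (0 : ℂ) (R + R))
    simpa using h1.mul_prod h2
  -- pull back along the measure-preserving shear `T (x, y) = (x, y - x)`
  have hT : MeasurePreserving (fun z : ℂ × ℂ ↦ (z.1, z.2 - z.1)) ((volume : Measure ℂ).prod volume)
      ((volume : Measure ℂ).prod volume) :=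
    measurePreserving_prod_sub (volume : Measure ℂ) (volume : Measure ℂ)
  have hcomp := hT.integrable_comp_of_integrable hg
  refine (hcomp.integrableOn (s := B ×ˢ B)).congr_fun ?_
    (measurableSet_closedBall.prod measurableSet_closedBall)
  rintro ⟨x, y⟩ ⟨hx, hy⟩
  have hx' : ‖x‖ ≤ R := by simpa [B, mem_closedBall, dist_zero_right] using hx
  have hy' : ‖y‖ ≤ R := by simpa [B, mem_closedBall, dist_zero_right] using hy
  have hmem : (x, y - x) ∈ B ×ˢ B' := by
    refine ⟨hx, ?_⟩
    simp only [B', mem_closedBall, dist_zero_right]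
    exact (norm_sub_le y x).trans (by linarith)
  simp only [Function.comp_apply, Set.indicator_of_mem hmem, norm_sub_rev]

/-- The same for the full-plane Green function `G_{ℝ²}(x, y) = -(1/2π) log ‖y - x‖`.
[cite: DuminilCopinKozlowskiLammersManolescu2026, (2.3)] -/
theorem integrableOn_fullPlaneGreen_prod (R : ℝ) :
    IntegrableOn (fun z : ℂ × ℂ ↦ fullPlaneGreen z.1 z.2) (closedBall (0 : ℂ) R ×ˢ closedBall (0 : ℂ) R)
      ((volume : Measure ℂ).prod volume) := by
  have h := (integrableOn_log_norm_sub_prod R).const_mul (-(1 / (2 * π)))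
  refine IntegrableOn.congr_fun h (fun z _ ↦ ?_) (measurableSet_closedBall.prod measurableSet_closedBall)
  simp only [fullPlaneGreen, norm_sub_rev]

/-- `y ↦ log ‖x - y‖` is integrable on every closed ball (translate of `log ‖·‖ ∈ L¹_loc`).
[cite: GrafakosMFA2014, Example 3.1.3] -/
theorem integrableOn_log_norm_sub_right (x : ℂ) (R : ℝ) :
    IntegrableOn (fun y : ℂ ↦ Real.log ‖x - y‖) (closedBall (0 : ℂ) R) volume := by
  have hK : IntegrableOn (fun w : ℂ ↦ Real.log ‖w‖) (closedBall (0 : ℂ) (R + ‖x‖)) volume :=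
    Literature.Analysis.FunctionSpaces.BMOLog.locallyIntegrable_log_norm.integrableOn_isCompact
      (isCompact_closedBall _ _)
  have hI : Integrable ((closedBall (0 : ℂ) (R + ‖x‖)).indicator fun w : ℂ ↦ Real.log ‖w‖) volume :=
    (integrable_indicator_iff measurableSet_closedBall).2 hK
  have hI' := hI.comp_sub_right x
  refine (hI'.integrableOn (s := closedBall (0 : ℂ) R)).congr_fun (fun y hy ↦ ?_) measurableSet_closedBall
  have hy' : ‖y‖ ≤ R := by simpa [mem_closedBall, dist_zero_right] using hy
  have hmem : y - x ∈ closedBall (0 : ℂ) (R + ‖x‖) := by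
    rw [mem_closedBall, dist_zero_right]
    exact (norm_sub_le y x).trans (by linarith)
  simp only [Set.indicator_of_mem hmem, norm_sub_rev]

/-! ### Bounded, compactly supported densities -/

section Volume

variable {f : ℂ → ℝ} {R C : ℝ}

/-- A function vanishing outside `B̄(0, R)` is its own restriction to that ball. [folklore] -/
theorem eq_indicator_closedBall_of_eq_zero (hR : ∀ z, R < ‖z‖ → f z = 0) :
    f = (closedBall (0 : ℂ) R).indicator f := by
  funext z
  by_cases hz : z ∈ closedBall (0 : ℂ) R
  · rw [indicator_of_mem hz]
  · rw [indicator_of_notMem hz, hR z (by simpa [mem_closedBall, dist_zero_right] using hz)]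

/-- A bounded measurable function vanishing outside a ball is integrable. [folklore] -/
theorem integrable_of_abs_le_of_eq_zero (hf : Measurable f) (hC : ∀ z, |f z| ≤ C)
    (hR : ∀ z, R < ‖z‖ → f z = 0) : Integrable f volume := by
  rw [eq_indicator_closedBall_of_eq_zero hR, integrable_indicator_iff measurableSet_closedBall]
  exact Measure.integrableOn_of_bounded (measure_closedBall_lt_top (x := (0 : ℂ)) (r := R)).ne
    hf.aestronglyMeasurable (Eventually.of_forall fun z ↦ by rw [Real.norm_eq_abs]; exact hC z)

/-- Domination: if `|f| ≤ C` vanishes off `B̄(0,R)` and `g ∈ L¹(B̄(0,R)²)`, then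
`(x, y) ↦ f(x) f(y) g(x, y)` is integrable on `ℂ × ℂ`. [folklore] -/
theorem integrable_mul_mul_of_integrableOn (hf : Measurable f) (hC : ∀ z, |f z| ≤ C)
    (hR : ∀ z, R < ‖z‖ → f z = 0) {g : ℂ × ℂ → ℝ}
    (hg : IntegrableOn g (closedBall (0 : ℂ) R ×ˢ closedBall (0 : ℂ) R) ((volume : Measure ℂ).prod volume)) :
    Integrable (fun z : ℂ × ℂ ↦ f z.1 * f z.2 * g z) ((volume : Measure ℂ).prod volume) := by
  set B : Set ℂ := closedBall 0 R
  have hB : MeasurableSet (B ×ˢ B) := measurableSet_closedBall.prod measurableSet_closedBall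
  have heq : (fun z : ℂ × ℂ ↦ f z.1 * f z.2 * g z) = (B ×ˢ B).indicator fun z ↦ f z.1 * f z.2 * g z := by
    funext z
    by_cases hz : z ∈ B ×ˢ B
    · rw [indicator_of_mem hz]
    · rw [indicator_of_notMem hz]
      rw [Set.mem_prod, not_and_or] at hz
      rcases hz with h | h
      · rw [hR z.1 (by simpa [B, mem_closedBall, dist_zero_right] using h), zero_mul, zero_mul]
      · rw [hR z.2 (by simpa [B, mem_closedBall, dist_zero_right] using h), mul_zero, zero_mul]
  rw [heq, integrable_indicator_iff hB]
  have hC0 : 0 ≤ C := (abs_nonneg _).trans (hC 0)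
  refine Integrable.mono' (hg.norm.const_mul (C * C)) ?_ (Eventually.of_forall fun z ↦ ?_)
  · exact (((hf.comp measurable_fst).mul (hf.comp measurable_snd)).aestronglyMeasurable).mul hg.1
  · rw [norm_mul, norm_mul, Real.norm_eq_abs, Real.norm_eq_abs]
    exact mul_le_mul_of_nonneg_right (mul_le_mul (hC _) (hC _) (abs_nonneg _) hC0) (norm_nonneg _)

/-- **Densities are generalised test functions** (DKLM Def. 5): for `f ∈ L¹(ℂ)` measurable,
vanishing outside `B̄(0, R)` and of integral zero, `f · Leb` is a finite, compactly supported
signed measure of total mass `0`. [cite: DuminilCopinKozlowskiLammersManolescu2026, Def. 5] -/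
theorem isGeneralisedTestFunction_withDensityᵥ (hf : Measurable f) (hfi : Integrable f volume)
    (hR : ∀ z, R < ‖z‖ → f z = 0) (h0 : ∫ z, f z = 0) :
    IsGeneralisedTestFunction ((volume : Measure ℂ).withDensityᵥ f) := by
  refine ⟨⟨R, ?_⟩, ?_⟩
  · rw [totalVariation_withDensityᵥ hf hfi, withDensity_apply _ measurableSet_closedBall.compl]
    refine setLIntegral_eq_zero measurableSet_closedBall.compl fun z hz ↦ ?_
    have hz' : R < ‖z‖ := by simpa [mem_closedBall, dist_zero_right] using hz
    simp [hR z hz']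
  · rw [withDensityᵥ_apply hfi MeasurableSet.univ, Measure.restrict_univ, h0]

/-- **Bounded compactly supported densities have finite Dirichlet energy** (DKLM Def. 6(ii)): for
`f` measurable with `|f| ≤ C` and `f = 0` outside `B̄(0, R)`, `|f · Leb| = |f| · Leb` has no atoms and
`G_{ℝ²} ∈ L¹(|f| Leb ⊗ |f| Leb)`, because `log ‖x - y‖ ∈ L¹(B̄(0,R)²)`.
[cite: DuminilCopinKozlowskiLammersManolescu2026, Def. 6(ii)] -/
theorem hasFiniteDirichletEnergy_withDensityᵥ (hf : Measurable f) (hC : ∀ z, |f z| ≤ C)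
    (hR : ∀ z, R < ‖z‖ → f z = 0) :
    HasFiniteDirichletEnergy ((volume : Measure ℂ).withDensityᵥ f) := by
  have hfi := integrable_of_abs_le_of_eq_zero hf hC hR
  refine ⟨fun x ↦ ?_, ?_⟩
  · rw [totalVariation_withDensityᵥ hf hfi, withDensity_apply _ (measurableSet_singleton x),
      setLIntegral_measure_zero _ _ (measure_singleton x)]
  · rw [totalVariation_withDensityᵥ hf hfi, prod_withDensity hf.enorm hf.enorm,
      integrable_withDensity_iff_integrable_smul' (by fun_prop)
        (Eventually.of_forall fun z ↦ ENNReal.mul_lt_top enorm_lt_top enorm_lt_top)]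
    have habs : ∀ z, |(fun z ↦ |f z|) z| ≤ C := fun z ↦ by simpa using hC z
    have hR' : ∀ z, R < ‖z‖ → (fun z ↦ |f z|) z = 0 := fun z hz ↦ by simp [hR z hz]
    have h := integrable_mul_mul_of_integrableOn (by fun_prop : Measurable fun z ↦ |f z|) habs hR'
      (integrableOn_fullPlaneGreen_prod R)
    refine h.congr (Eventually.of_forall fun z ↦ ?_)
    simp only [ENNReal.toReal_mul, toReal_enorm, Real.norm_eq_abs, smul_eq_mul]

/-- The inner energy integral of a density: `∫ log ‖x - y‖ d(f Leb)(y) = ∫ f(y) log ‖x - y‖ dy`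
for every `x`. [cite: DuminilCopinKozlowskiLammersManolescu2026, Def. 6(ii)] -/
theorem signedIntegral_withDensityᵥ_log_norm_sub (hf : Measurable f) (hC : ∀ z, |f z| ≤ C)
    (hR : ∀ z, R < ‖z‖ → f z = 0) (x : ℂ) :
    signedIntegral ((volume : Measure ℂ).withDensityᵥ f) (fun y ↦ Real.log ‖x - y‖) =
      ∫ y, f y * Real.log ‖x - y‖ := by
  have hfi := integrable_of_abs_le_of_eq_zero hf hC hR
  have hmeas : Measurable fun y : ℂ ↦ Real.log ‖x - y‖ :=
    Real.measurable_log.comp (continuous_const.sub continuous_id).norm.measurable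
  refine signedIntegral_withDensityᵥ hf hfi hmeas.aestronglyMeasurable ?_
  -- `f(y) log ‖x - y‖` vanishes off the ball and is dominated by `C |log ‖x - y‖|` on it
  have heq : (fun y ↦ f y * Real.log ‖x - y‖) =
      (closedBall (0 : ℂ) R).indicator fun y ↦ f y * Real.log ‖x - y‖ := by
    funext y
    by_cases hy : y ∈ closedBall (0 : ℂ) R
    · rw [indicator_of_mem hy]
    · rw [indicator_of_notMem hy, hR y (by simpa [mem_closedBall, dist_zero_right] using hy), zero_mul]
  rw [heq, integrable_indicator_iff measurableSet_closedBall]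
  have hC0 : 0 ≤ C := (abs_nonneg _).trans (hC 0)
  refine Integrable.mono' ((integrableOn_log_norm_sub_right x R).norm.const_mul C)
    ((hf.mul hmeas).aestronglyMeasurable) (Eventually.of_forall fun y ↦ ?_)
  rw [norm_mul, Real.norm_eq_abs]
  exact mul_le_mul_of_nonneg_right (hC y) (norm_nonneg _)

/-- **The Dirichlet energy of a density** (DKLM Def. 6(ii) for `φ = f dx`): for `f` measurable,
bounded and vanishing outside a ball,
`∬ G_{ℝ²} dφ dφ = -(1/2π) ∫ (∫ log ‖x - y‖ f(x) f(y) dy) dx` (Lebesgue integrals).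
[cite: DuminilCopinKozlowskiLammersManolescu2026, Def. 6(ii)] -/
theorem dirichletEnergy_withDensityᵥ (hf : Measurable f) (hC : ∀ z, |f z| ≤ C)
    (hR : ∀ z, R < ‖z‖ → f z = 0) :
    dirichletEnergy ((volume : Measure ℂ).withDensityᵥ f) =
      -(1 / (2 * π)) * ∫ x, ∫ y, Real.log ‖x - y‖ * f x * f y := by
  have hfi := integrable_of_abs_le_of_eq_zero hf hC hR
  rw [dirichletEnergy_eq]
  congr 1
  have hinner : (fun x ↦ signedIntegral ((volume : Measure ℂ).withDensityᵥ f) fun y ↦ Real.log ‖x - y‖) =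
      fun x ↦ ∫ y, f y * Real.log ‖x - y‖ :=
    funext (signedIntegral_withDensityᵥ_log_norm_sub hf hC hR)
  rw [hinner]
  -- the integrand `F (x, y) = f x * f y * log ‖x - y‖` is integrable on `ℂ × ℂ`
  have hF : Integrable (fun z : ℂ × ℂ ↦ f z.1 * f z.2 * Real.log ‖z.1 - z.2‖)
      ((volume : Measure ℂ).prod volume) :=
    integrable_mul_mul_of_integrableOn hf hC hR (integrableOn_log_norm_sub_prod R)
  have hmeasF : Measurable fun z : ℂ × ℂ ↦ f z.2 * Real.log ‖z.1 - z.2‖ :=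
    (hf.comp measurable_snd).mul
      (Real.measurable_log.comp (continuous_fst.sub continuous_snd).norm.measurable)
  rw [signedIntegral_withDensityᵥ hf hfi]
  · congr 1
    funext x
    rw [← integral_const_mul]
    congr 1
    funext y
    ring
  · exact (hmeasF.aestronglyMeasurable (μ := (volume : Measure ℂ).prod volume)).integral_prod_right'
  · refine (hF.integral_prod_left).congr (Eventually.of_forall fun x ↦ ?_)
    simp only
    rw [← integral_const_mul]
    congr 1
    funext y
    ring

end Volume

end Literature.Probability.Percolation

end
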